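import Summits.CriticalPhenomena.PercolationContinuityZ3.Theorems.PercNearOneGluingNoHeavyPcintBSMRFast3S
import Summits.CriticalPhenomena.PercolationContinuityZ3.Theorems.PercNearOneGluingNoHeavyPcintBSMRSiteAssembly
import HarnessLib

/-!
# PCINT lane, PHASE 11 (reach-4 pieces), SITE version: the bit-mask site functional for general reach

Cell `prim-pcint`, seat `prim-pcint-1` (gen 18); memo `run/shared/lean/prim/pcint/T-FIBRE-ROUTE.md` §PHASE 11.
…PcintBSMRFast3S proves `BSMX.SV2 = BSMR.Smask` and the bridge `BSMR.certLHSVz_eq_certFastMS` for pieces of length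
`≤ 6` and offsets `|y| ≤ 6` (reach 3).  The vertex code `(x+12)·25 + (y+12)` is injective on `[-12,12]^2`, so the
same functional serves ANY reach `m` with reward box `[-2m,2m]^2` as long as `m + 2m ≤ 12`, i.e. `m ≤ 4`: here the two
statements are re-proved with the block-vertex bound taken from `BSMR.VertCube m` (**`BSMR.tverts2_bound_of_vertCube`**)
instead of the piece length — **`BSMR.SV2_eq_Smask_of_bounds`**, **`BSMR.certLHSVz_eq_certFastMS_of_bounds`**.
No new tables or definitions.
-/

noncomputable section

namespace Summit.CriticalPhenomena.PercolationContinuityZ3.Theorems.Pcint.BSMR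

open Finset OSM BSM BSMX Literature.Probability.Percolation Literature.Probability.LatticeModels

variable {np k : ℕ}

/-- Block vertices (start and entered vertices, pair form) of a piece family in the reach-`m` vertex cube have
coordinates at most `m` in absolute value. -/
theorem tverts2_bound_of_vertCube {m : ℕ} {pc : Fin np → List (Fin 2 × Bool)} (hvc : VertCube m pc k) (σ : Fin np) :
    ∀ a ∈ insert ((0 : Fin k → ℤ), ((0 : ℤ), (0 : ℤ))) (tverts2 k (0, 0) (pc σ)), |a.2.1| ≤ m ∧ |a.2.2| ≤ m := by
  intro a ha
  rw [Finset.mem_insert] at ha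
  rcases ha with rfl | ha
  · simp
  · rw [show ((0 : ℤ), (0 : ℤ)) = tr2 (0 : Fin 2 → ℤ) from rfl, ← tverts_map_embV2, Finset.mem_map] at ha
    obtain ⟨q, hq, rfl⟩ := ha
    have h0 := hvc σ q hq 0
    have h1 := hvc σ q hq 1
    simp only [embV2, Function.Embedding.coeFn_mk, tr2]
    exact ⟨abs_le.2 h0, abs_le.2 h1⟩

/-- **`SV2 = Smask`** on the vertex bit lists, for block vertices with coordinates `≤ Rv` in absolute value,
offsets `|y| ≤ Ry`, `Rv + Ry ≤ 12` (the code range), first list duplicate-free.  (…PcintBSMRFast3S's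
`SV2_eq_Smask` is the case `Rv = |σ| ≤ 6`, `Ry = 6`.) -/
theorem SV2_eq_Smask_of_bounds (pc : Fin np → List (Fin 2 × Bool)) (k : ℕ) (y : Fin 2 → ℤ) (σ σ' : Fin np)
    {bA bB : List ℕ} (hA : bA = tvbits (0, 0) (pc σ)) (hB : bB = tvbits (0, 0) (pc σ')) (hAn : bA.Nodup)
    {Rv Ry : ℤ} (hR : Rv + Ry ≤ 12) (hRy : 0 ≤ Ry)
    (hvA : ∀ a ∈ insert ((0 : Fin k → ℤ), ((0 : ℤ), (0 : ℤ))) (tverts2 k (0, 0) (pc σ)), |a.2.1| ≤ Rv ∧ |a.2.2| ≤ Rv)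
    (hvB : ∀ b ∈ insert ((0 : Fin k → ℤ), ((0 : ℤ), (0 : ℤ))) (tverts2 k (0, 0) (pc σ')), |b.2.1| ≤ Rv ∧ |b.2.2| ≤ Rv)
    (hy0 : |y 0| ≤ Ry) (hy1 : |y 1| ≤ Ry) :
    SV2 pc k y σ σ' = Smask (maskOf (bA.map (· + 312))) (bA.map (· + 312)) (Nat.shiftLeft (maskOf bB) (shOfV (tr2 y))) := by
  set TA := insert ((0 : Fin k → ℤ), ((0 : ℤ), (0 : ℤ))) (tverts2 k (0, 0) (pc σ)) with hTA
  set TB := insert ((0 : Fin k → ℤ), ((0 : ℤ), (0 : ℤ))) (tverts2 k (0, 0) (pc σ')) with hTB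
  set sh := shiftV2 k (tr2 y) with hsh
  set s : ℕ := shOfV (tr2 y) with hs
  have hy0' : |(tr2 y).1| ≤ Ry := hy0
  have hy1' : |(tr2 y).2| ≤ Ry := hy1
  rw [abs_le] at hy0' hy1'
  have hRv : 0 ≤ Rv := by
    have h := (hvA _ (Finset.mem_insert_self _ _)).1
    simp only [abs_zero] at h
    exact h
  have hoff : 312 + voff (tr2 y) ≥ 0 := by unfold voff; omega
  have hs' : (s : ℤ) = 312 + voff (tr2 y) := by rw [hs, shOfV, Int.toNat_of_nonneg hoff]
  have smA : ∀ a ∈ TA, a.1 = 0 ∧ |a.2.1| ≤ Rv ∧ |a.2.2| ≤ Rv := fun a ha =>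
    ⟨(mem_verts ha).1, (hvA a ha).1, (hvA a ha).2⟩
  have smB : ∀ b ∈ TB, b.1 = 0 ∧ |b.2.1| ≤ Rv ∧ |b.2.2| ≤ Rv := fun b hb =>
    ⟨(mem_verts hb).1, (hvB b hb).1, (hvB b hb).2⟩
  have hbA : bA.toFinset = TA.image vcodeK := by rw [hA, hTA, image_vcodeK_verts]
  have hbB : bB.toFinset = TB.image vcodeK := by rw [hB, hTB, image_vcodeK_verts]
  have hbit : ∀ e ∈ TA, ((Nat.land (maskOf (bA.map (· + 312))) (Nat.shiftLeft (maskOf bB) s)).testBit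
      (vcodeK e + 312) = true ↔ e ∈ TB.map sh) := by
    intro e he
    obtain ⟨het, he1, he2⟩ := smA e he
    rw [abs_le] at he1 he2
    rw [show Nat.land (maskOf (bA.map (· + 312))) (Nat.shiftLeft (maskOf bB) s) =
      (maskOf (bA.map (· + 312))) &&& ((maskOf bB) <<< s) from rfl, Nat.testBit_and, Nat.testBit_shiftLeft,
      testBit_maskOf, testBit_maskOf]
    have hmemA : vcodeK e + 312 ∈ bA.map (· + 312) := by
      rw [List.mem_map]
      exact ⟨vcodeK e, by rw [← List.mem_toFinset, hbA, Finset.mem_image]; exact ⟨e, he, rfl⟩, rfl⟩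
    have hcode : ((vcodeK e : ℕ) : ℤ) = vcodeK (shiftV2 k (-(tr2 y)) e) + voff (tr2 y) := by
      have := vcodeK_shift (k := k) (tr2 y) (q := shiftV2 k (-(tr2 y)) e)
        (by simp [shiftV2]; omega) (by simp [shiftV2]; omega) (by simp [shiftV2]; omega) (by simp [shiftV2]; omega)
      have e2 : shiftV2 k (tr2 y) (shiftV2 k (-(tr2 y)) e) = e := by
        simp [shiftV2]
      rw [e2] at this
      exact this
    have hge : s ≤ vcodeK e + 312 := by
      have h0 : (0 : ℤ) ≤ (vcodeK (shiftV2 k (-(tr2 y)) e) : ℕ) := Nat.cast_nonneg _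
      omega
    have hsub : vcodeK e + 312 - s = vcodeK (shiftV2 k (-(tr2 y)) e) := by omega
    simp only [hmemA, decide_true, Bool.true_and, ge_iff_le, hge, hsub, decide_eq_true_eq]
    rw [← List.mem_toFinset, hbB, Finset.mem_image, Finset.mem_map]
    constructor
    · rintro ⟨b, hb, hbe⟩
      obtain ⟨hbt, hb1, hb2⟩ := smB b hb
      have heq := vcodeK_inj hbt (by simpa [shiftV2] using het) (hb1.trans (by omega)) (hb2.trans (by omega))
        (by simp only [shiftV2, Function.Embedding.coeFn_mk, Prod.fst_add, Prod.fst_neg, abs_le]; omega)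
        (by simp only [shiftV2, Function.Embedding.coeFn_mk, Prod.snd_add, Prod.snd_neg, abs_le]; omega) hbe
      refine ⟨b, hb, ?_⟩
      rw [heq]; simp [hsh, shiftV2]
    · rintro ⟨b, hb, rfl⟩
      refine ⟨b, hb, ?_⟩
      congr 1
      simp [hsh, shiftV2]
  unfold SV2
  rw [← hTA, ← hTB, ← hsh, Smask_eq]
  have step1 : TA ∩ TB.map sh = TA.filter (fun e => e ∈ TB.map sh) := by
    ext e; simp [Finset.mem_inter, Finset.mem_filter]
  rw [step1]
  have hinjA : Set.InjOn vcodeK (TA : Set (VKey2 k)) := fun a ha a' ha' h =>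
    vcodeK_inj (smA a ha).1 (smA a' ha').1 ((smA a ha).2.1.trans (by omega)) ((smA a ha).2.2.trans (by omega))
      ((smA a' ha').2.1.trans (by omega)) ((smA a' ha').2.2.trans (by omega)) h
  set p : ℕ → Bool := fun i => (Nat.land (maskOf (bA.map (· + 312))) (Nat.shiftLeft (maskOf bB) s)).testBit i with hp
  rw [Finset.filter_congr (fun e he => (hbit e he).symm)]
  rw [← Finset.card_image_of_injOn (hinjA.mono (Finset.coe_subset.2 (Finset.filter_subset _ _)))]
  have step3 : (TA.filter fun e => p (vcodeK e + 312) = true).image vcodeK =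
      (TA.image vcodeK).filter fun c => p (c + 312) = true := by
    ext c
    simp only [Finset.mem_image, Finset.mem_filter]
    constructor
    · rintro ⟨b, ⟨hb, hq⟩, rfl⟩; exact ⟨⟨b, hb, rfl⟩, hq⟩
    · rintro ⟨⟨b, hb, rfl⟩, hq⟩; exact ⟨b, ⟨hb, hq⟩, rfl⟩
  rw [step3, ← hbA, ← List.toFinset_filter, List.toFinset_card_of_nodup (hAn.filter _), List.filter_map,
    List.length_map]
  rfl

/-- **The bridge with general bounds**: `BSMX.certLHSVz` (true shared-vertex count `BSMX.SV`, pair-indexed tables)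
equals the cast of `BSMR.certFastMS`, for pieces whose block vertices lie in the reach-`m` cube (`BSMR.VertCube`),
offsets `|y| ≤ Ry` with `m + Ry ≤ 12`, and `B ≤ A` (reach `m ≤ 4` with the reward box `Ry = 2m`). -/
theorem certLHSVz_eq_certFastMS_of_bounds (pc : Fin np → List (Fin 2 × Bool)) (RS : List (ℕ × (ℤ × ℤ) × List ℕ))
    (hlen : RS.length = np) (W : Fin np → ℕ)
    (hRS : ∀ σ : Fin np, RS.getD σ (0, (0, 0), []) = (W σ, tr2 (pend (pc σ)), tvbits (0, 0) (pc σ)))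
    (hnd : ∀ σ, (tvbits (0, 0) (pc σ)).Nodup) {m : ℕ} (k : ℕ) (hvc : VertCube m pc k) {Ry : ℤ}
    (hR : (m : ℤ) + Ry ≤ 12) (hRy : 0 ≤ Ry)
    (A B E : ℕ) (hBA : B ≤ A) (hE : ∀ σ, (pc σ).length + 1 ≤ E) (V0t V1t : ℤ × ℤ → ℕ) {y : Fin 2 → ℤ}
    (hy0 : |y 0| ≤ Ry) (hy1 : |y 1| ≤ Ry) :
    certLHSVz (fun σ => pend (pc σ)) (SV pc k) W k A B E (fun u => V0t (tr2 u)) (fun u => V1t (tr2 u)) y =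
      ((certFastMS RS k A B E V0t V1t (tr2 y) (shOfV (tr2 y)) : ℕ) : ℤ) := by
  subst hlen
  have hget : ∀ σ : Fin RS.length, RS[(σ : ℕ)] = (W σ, tr2 (pend (pc σ)), tvbits (0, 0) (pc σ)) := fun σ => by
    rw [← hRS σ, List.getD_eq_getElem _ _ σ.2]
  have hsum : ∀ (f : Fin RS.length → ℤ) (F : ℕ × (ℤ × ℤ) × List ℕ → ℤ),
      (∀ i : Fin RS.length, f i = F RS[(i : ℕ)]) → ∑ i, f i = (RS.map F).sum := by
    intro f F h
    have : List.ofFn f = RS.map F := by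
      apply List.ext_getElem (by simp)
      intro i h1 h2
      rw [List.getElem_ofFn, List.getElem_map, h ⟨i, by simpa using h1⟩]
    rw [← List.sum_ofFn, this]
  unfold certLHSVz certFastMS
  dsimp only
  rw [Nat.cast_list_sum, List.map_map]
  refine hsum _ _ fun σ => ?_
  rw [Function.comp_apply, Nat.cast_list_sum, List.map_map, List.map_map]
  refine hsum _ _ fun σ' => ?_
  rw [Function.comp_apply, Function.comp_apply, hget σ, hget σ', termMS_eq]
  dsimp only
  have hS : Smask (maskOf ((tvbits (0, 0) (pc σ)).map (· + 312))) ((tvbits (0, 0) (pc σ)).map (· + 312))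
      (Nat.shiftLeft (maskOf (tvbits (0, 0) (pc σ'))) (shOfV (tr2 y))) = SV pc k y σ σ' := by
    rw [SV_eq_SV2, SV2_eq_Smask_of_bounds pc k y σ σ' rfl rfl (hnd σ) hR hRy (tverts2_bound_of_vertCube hvc σ)
      (tverts2_bound_of_vertCube hvc σ') hy0 hy1]
  rw [hS]
  have hs : SV pc k y σ σ' ≤ E := (SV_le_length pc k y σ σ').trans (hE σ)
  have h2 : B ^ E ≤ A ^ SV pc k y σ σ' * B ^ (E - SV pc k y σ σ') := by
    calc B ^ E = B ^ SV pc k y σ σ' * B ^ (E - SV pc k y σ σ') := by rw [← pow_add, Nat.add_sub_cancel' hs]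
      _ ≤ A ^ SV pc k y σ σ' * B ^ (E - SV pc k y σ σ') := Nat.mul_le_mul_right _ (Nat.pow_le_pow_left hBA _)
  have huo : tr2 y + (tr2 (pend (pc σ')) - tr2 (pend (pc σ))) = tr2 (y + (pend (pc σ') - pend (pc σ))) := by
    rw [tr2_add, tr2_sub]
  rw [huo]
  push_cast [Nat.cast_sub h2]
  ring

end Summit.CriticalPhenomena.PercolationContinuityZ3.Theorems.Pcint.BSMR

end
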